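import Summits.HodgeConjecture.HodgeConjecture.Theorems.Ring2WeilCoverageWeilGramLevel15
import HarnessLib

/-!
# Weil-type family coverage — THE COMPONENTS OF THE WEIL-TYPE `ℤ[ζ₁₅]`-FOURFOLDS, III: `K_d = ℚ(√−15)`
# (`s₁₅ = (1 + 2ζ⁵)(1 + 2(ζ³ + ζ¹²))`, `s₁₅² = −15`), the principal-type form: `det a = −3600 = −60²`, class `[−1]`

research route conditional on HC_CM; not a corollary; Q11.4-sentence-2 already refuted in dim ≥ 3.

Ring 2, WEIL-TYPE FAMILY-COVERAGE CENSUS (`HOME/WEIL-FAMILY-COVERAGE.md` `## b01`, blocks b01.41 (C), b01.46 (C2), owner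
ring2-b01), part 85 of the `Ring2WeilCoverage*` series; the `ℚ(√−15)`-row companion of part 83 (frame `θ^i`, `θ = ζ + ζ⁻¹`,
`ξ = ζ³/Φ₁₅′(ζ)`).

* §0 `r₅ = 1 + 2(ζ³ + ζ¹²)` is real with `r₅² = 5` (Gauss sum of `ℚ(ζ₅) ⊂ ℚ(ζ₁₅)`), so `s₁₅ = s₃ r₅` is skew with
  `s₁₅² = −15`: `ℚ(s₁₅) = ℚ(√−15) ⊂ K`, the other imaginary quadratic subfield.
* §1 the seven traces `Tr(ξ s₁₅ θ^m)` and the Gram datum of `(E_ξ, s₁₅)` in the frame `θ^i`: `b = 0`,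
  **`a = −(2,0,8,4 / 0,8,4,34 / 8,4,34,18 / 4,34,18,130)`, `det a = −3600`** (`= N_{K⁺/ℚ}(r₅)·(−144) = 25·(−144)`).
* §2 **EVERY skew `ζ′` of principal type on `ℤ[ζ₁₅]` gives `−3600`** (part 82 + THEOREM L (i) at `15`): class
  **`[−1] ≠ [1]`** in `ℚˣ/Nm(ℚ(√−15)ˣ)`, and `(−1)² det a < 0` is the wrong sign for Weil signature `(2,2)`
  [vG94 5.2 (4), quoted] — the census NO row `(15, √−15)` (part 75 `not_exists_principal_fifteen_sqrt_neg_fifteen`)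
  re-read from a determinant.  Part 86: the type `𝔮₅` for `ℚ(√−15)`.

HONEST FRAMING as parts 82–84; `HC_CM` is used nowhere.  No `def`, no named fact, no `sorry`.  Certificates from
`work/py/gen15.py`, re-verified by `linear_combination`.

References: [cite: vanGeemen1994HodgeAV, Lemma 5.2 (2)–(4), 5.4 and (5.4.1)]; [cite: Shimura1998, §14.3 Prop. 4–5,
pp. 103–104]; census b01.41 (C), b01.46 (C2) (seat-derived).
-/

noncomputable section

open Polynomial NumberField Module
open scoped nonZeroDivisors

namespace Summit.HodgeConjecture.Ring2WeilCoverage.WeilGramLevel15SqrtNegFifteen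

open Literature.AlgebraicGeometry.VanGeemen1994 (weilField weilNormResidueGroup)
open Literature.AlgebraicGeometry.Motives (CMType normUnitsSubgroup)
open Literature.NumberTheory.ComplexMultiplication
open Summit.HodgeConjecture.Ring2WeilCoverage.WeilGramCMPoint
open Summit.HodgeConjecture.Ring2WeilCoverage.WeilGramLevel15
open Summit.HodgeConjecture.Ring2WeilCoverage.RealUnitNormHalfSystems (complexConj_eq_inv)
open Summit.HodgeConjecture.Ring2WeilCoverage.CyclotomicDifferent (isOfType_one_xi_top xi_ne_zero)
open Summit.HodgeConjecture.Ring2WeilCoverage.RamifiedTypes (isOfType_one_gen_mul_xi complexConj_gen_mul_xi gen_ne_zero)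
open Summit.HodgeConjecture.Ring2WeilCoverage.RamifiedTypesLevel15
open Summit.HodgeConjecture.Ring2WeilCoverage.RealUnitNormAllLevels (norm_realUnits_pos_fifteen)
open Summit.HodgeConjecture.HodgeConjecture.Ring2.WeilCoverage (mk_ne_split_of_even mk_eq_split_of_even
  natCast_not_mem_normUnitsSubgroup_of_inert natCast_not_mem_normUnitsSubgroup_of_ramified
  not_mem_normUnitsSubgroup_of_not_exists mem_normUnitsSubgroup_of_sq_add_mul_sq)
open Summit.HodgeConjecture.HodgeConjecture.Ring2.Hypotheses (splitDiscriminantClass)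

variable {K : Type} [Field K] [NumberField K] {ζ : K}

/-! ### §0 `s₁₅ = s₃·r₅`, `r₅ = 1 + 2(ζ³ + ζ¹²) = √5` -/

/-- `r₅ = 1 + 2(ζ³ + ζ¹²)` (`= √5`) is real. [folklore] -/
theorem complexConj_sqrtFive [IsCMField K] (hζ : IsPrimitiveRoot ζ 15) :
    IsCMField.complexConj K (1 + 2 * (ζ ^ 3 + ζ ^ 12)) = 1 + 2 * (ζ ^ 3 + ζ ^ 12) := by
  rw [map_add, map_mul, map_add, map_pow, map_pow, complexConj_eq_inv hζ, map_one, map_ofNat,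
    inv_pow_eq_pow hζ (show 3 + 12 = 15 by norm_num), inv_pow_eq_pow hζ (show 12 + 3 = 15 by norm_num), add_comm (ζ ^ 12)]

omit [NumberField K] in
/-- `r₅² = 5` for `r₅ = 1 + 2(ζ³ + ζ¹²)` (the Gauss sum of `ℚ(ζ₅) ⊂ ℚ(ζ₁₅)`). [folklore] -/
theorem sq_sqrtFive (hζ : IsPrimitiveRoot ζ 15) : (1 + 2 * (ζ ^ 3 + ζ ^ 12)) ^ 2 = 5 := by
  have h15 : ζ ^ 15 = 1 := hζ.pow_eq_one
  have h3 : ζ ^ 3 - 1 ≠ 0 := sub_ne_zero.mpr (hζ.pow_ne_one_of_pos_of_lt (by norm_num) (by norm_num))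
  have h : (ζ ^ 3 - 1) * ((1 + 2 * (ζ ^ 3 + ζ ^ 12)) ^ 2 - 5) = 0 := by
    linear_combination (4 * ζ ^ 12 - 4 * ζ ^ 9 + 8 * ζ ^ 3 - 4) * h15
  rcases mul_eq_zero.mp h with h' | h'
  · exact absurd h' h3
  · exact sub_eq_zero.mp h'

omit [NumberField K] in
/-- **`s₁₅² = −15`** for `s₁₅ = (1 + 2ζ⁵)(1 + 2(ζ³ + ζ¹²))`. [folklore] -/
theorem sq_sqrtNegFifteen (hζ : IsPrimitiveRoot ζ 15) :
    ((1 + 2 * ζ ^ 5) * (1 + 2 * (ζ ^ 3 + ζ ^ 12))) ^ 2 = -15 := by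
  rw [mul_pow, sq_sqrtNegThree hζ, sq_sqrtFive hζ]; norm_num

/-- **`s₁₅` is skew.** [folklore] -/
theorem complexConj_sqrtNegFifteen [IsCMField K] (hζ : IsPrimitiveRoot ζ 15) :
    IsCMField.complexConj K ((1 + 2 * ζ ^ 5) * (1 + 2 * (ζ ^ 3 + ζ ^ 12))) =
      -((1 + 2 * ζ ^ 5) * (1 + 2 * (ζ ^ 3 + ζ ^ 12))) := by
  rw [map_mul, complexConj_sqrtNegThree hζ, complexConj_sqrtFive hζ, neg_mul]


/-! ### §1 The principal-type form for `K_d = ℚ(√−15)`: `det a = −3600` -/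

/-- `Tr(ζ′sθ^0) = 2` for `ζ′ = ξ = ζ³/Φ₁₅′(ζ)`, `s = √−15 = (1 + 2ζ⁵)(1 + 2(ζ³ + ζ¹²))`, `θ = ζ + ζ⁻¹` (Euler evaluation). research route conditional on HC_CM; not a corollary; Q11.4-sentence-2 already refuted in dim ≥ 3. [folklore] -/
theorem trace_xi_sqrtNegFifteen_zero [IsCyclotomicExtension {15} ℚ K] (hζ : IsPrimitiveRoot ζ 15) :
    Algebra.trace ℚ K ((ζ ^ 3 * (aeval ζ (derivative (cyclotomic 15 ℚ)))⁻¹) * ((1 + 2 * ζ ^ 5) * (1 + 2 * (ζ ^ 3 + ζ ^ 12)))) = 2 := by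
  have h15 : ζ ^ 15 = 1 := hζ.pow_eq_one
  have hΦ := cyc_fifteen hζ
  rw [trace_of_key₀ hζ (C (-2 : ℚ) * X + C (-1 : ℚ) * X ^ 3 + C (2 : ℚ) * X ^ 4 + C (2 : ℚ) * X ^ 5 + C (-2 : ℚ) * X ^ 6 +
      C (2 : ℚ) * X ^ 7) (by compute_degree) (by
    simp only [map_add, map_mul, map_pow, aeval_C, aeval_X, map_neg, eq_ratCast, Rat.cast_ofNat]
    linear_combination ((aeval ζ (derivative (cyclotomic 15 ℚ)))⁻¹ * (2 + 4 * ζ + 4 * ζ^2 + 4 * ζ^3)) * hΦ +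
      ((aeval ζ (derivative (cyclotomic 15 ℚ)))⁻¹ * (2 + 4 * ζ^5)) * h15)]
  norm_num [coeff_X_pow, coeff_X, coeff_C]

/-- `Tr(ζ′sθ^1) = 0` for `ζ′ = ξ = ζ³/Φ₁₅′(ζ)`, `s = √−15 = (1 + 2ζ⁵)(1 + 2(ζ³ + ζ¹²))`, `θ = ζ + ζ⁻¹` (Euler evaluation). research route conditional on HC_CM; not a corollary; Q11.4-sentence-2 already refuted in dim ≥ 3. [folklore] -/
theorem trace_xi_sqrtNegFifteen_one [IsCyclotomicExtension {15} ℚ K] (hζ : IsPrimitiveRoot ζ 15) :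
    Algebra.trace ℚ K ((ζ ^ 3 * (aeval ζ (derivative (cyclotomic 15 ℚ)))⁻¹) * ((1 + 2 * ζ ^ 5) * (1 + 2 * (ζ ^ 3 + ζ ^ 12))) * (ζ + ζ⁻¹)) = 0 := by
  have h15 : ζ ^ 15 = 1 := hζ.pow_eq_one
  have hΦ := cyc_fifteen hζ
  rw [trace_of_key₁ hζ (C (-4 : ℚ) + C (2 : ℚ) * X + C (-3 : ℚ) * X ^ 2 + C (3 : ℚ) * X ^ 4 + C (-2 : ℚ) * X ^ 5 +
      C (4 : ℚ) * X ^ 6 + C (0 : ℚ) * X ^ 7) (by compute_degree) (by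
    simp only [map_add, map_mul, map_pow, aeval_C, aeval_X, map_neg, eq_ratCast, Rat.cast_ofNat]
    linear_combination ((aeval ζ (derivative (cyclotomic 15 ℚ)))⁻¹ * (2 + 6 * ζ + 6 * ζ^2 + 8 * ζ^3 + 4 * ζ^4 + 4 * ζ^5)) * hΦ +
      ((aeval ζ (derivative (cyclotomic 15 ℚ)))⁻¹ * (2 + 2 * ζ^2 + 4 * ζ^5 + 4 * ζ^7)) * h15)]
  norm_num [coeff_X_pow, coeff_X, coeff_C]

/-- `Tr(ζ′sθ^2) = 8` for `ζ′ = ξ = ζ³/Φ₁₅′(ζ)`, `s = √−15 = (1 + 2ζ⁵)(1 + 2(ζ³ + ζ¹²))`, `θ = ζ + ζ⁻¹` (Euler evaluation). research route conditional on HC_CM; not a corollary; Q11.4-sentence-2 already refuted in dim ≥ 3. [folklore] -/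
theorem trace_xi_sqrtNegFifteen_two [IsCyclotomicExtension {15} ℚ K] (hζ : IsPrimitiveRoot ζ 15) :
    Algebra.trace ℚ K ((ζ ^ 3 * (aeval ζ (derivative (cyclotomic 15 ℚ)))⁻¹) * ((1 + 2 * ζ ^ 5) * (1 + 2 * (ζ ^ 3 + ζ ^ 12))) * (ζ + ζ⁻¹) ^ 2) = 8 := by
  have h15 : ζ ^ 15 = 1 := hζ.pow_eq_one
  have hΦ := cyc_fifteen hζ
  rw [trace_of_key hζ (C (-2 : ℚ) + C (-7 : ℚ) * X + C (6 : ℚ) * X ^ 2 + C (-4 : ℚ) * X ^ 3 + C (2 : ℚ) * X ^ 4 +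
      C (7 : ℚ) * X ^ 5 + C (-6 : ℚ) * X ^ 6 + C (8 : ℚ) * X ^ 7) (by compute_degree) (by
    simp only [map_add, map_mul, map_pow, aeval_C, aeval_X, map_neg, eq_ratCast, Rat.cast_ofNat]
    linear_combination ((aeval ζ (derivative (cyclotomic 15 ℚ)))⁻¹ * (6 + 6 * ζ + 12 * ζ^2 + 14 * ζ^3 + 10 * ζ^4 +
        8 * ζ^5)) * hΦ +
      ((aeval ζ (derivative (cyclotomic 15 ℚ)))⁻¹ * (6 + 4 * ζ^2 + 2 * ζ^4 + 4 * ζ^5 + 8 * ζ^7 +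
        4 * ζ^9)) * h15)]
  norm_num [coeff_X_pow, coeff_X, coeff_C]

/-- `Tr(ζ′sθ^3) = 4` for `ζ′ = ξ = ζ³/Φ₁₅′(ζ)`, `s = √−15 = (1 + 2ζ⁵)(1 + 2(ζ³ + ζ¹²))`, `θ = ζ + ζ⁻¹` (Euler evaluation). research route conditional on HC_CM; not a corollary; Q11.4-sentence-2 already refuted in dim ≥ 3. [folklore] -/
theorem trace_xi_sqrtNegFifteen_three [IsCyclotomicExtension {15} ℚ K] (hζ : IsPrimitiveRoot ζ 15) :
    Algebra.trace ℚ K ((ζ ^ 3 * (aeval ζ (derivative (cyclotomic 15 ℚ)))⁻¹) * ((1 + 2 * ζ ^ 5) * (1 + 2 * (ζ ^ 3 + ζ ^ 12))) * (ζ + ζ⁻¹) ^ 3) = 4 := by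
  have h15 : ζ ^ 15 = 1 := hζ.pow_eq_one
  have hΦ := cyc_fifteen hζ
  rw [trace_of_key hζ (C (-17 : ℚ) + C (12 : ℚ) * X + C (-9 : ℚ) * X ^ 2 + C (-2 : ℚ) * X ^ 3 + C (13 : ℚ) * X ^ 4 +
      C (-12 : ℚ) * X ^ 5 + C (13 : ℚ) * X ^ 6 + C (4 : ℚ) * X ^ 7) (by compute_degree) (by
    simp only [map_add, map_mul, map_pow, aeval_C, aeval_X, map_neg, eq_ratCast, Rat.cast_ofNat]
    linear_combination ((aeval ζ (derivative (cyclotomic 15 ℚ)))⁻¹ * (14 + 14 * ζ + 24 * ζ^2 + 28 * ζ^3 + 22 * ζ^4 + 14 * ζ^5 +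
        2 * ζ^6)) * hΦ +
      ((aeval ζ (derivative (cyclotomic 15 ℚ)))⁻¹ * (14 + 10 * ζ^2 + 6 * ζ^4 + 4 * ζ^5 + 2 * ζ^6 + 12 * ζ^7 +
        12 * ζ^9 + 4 * ζ^11)) * h15)]
  norm_num [coeff_X_pow, coeff_X, coeff_C]

/-- `Tr(ζ′sθ^4) = 34` for `ζ′ = ξ = ζ³/Φ₁₅′(ζ)`, `s = √−15 = (1 + 2ζ⁵)(1 + 2(ζ³ + ζ¹²))`, `θ = ζ + ζ⁻¹` (Euler evaluation). research route conditional on HC_CM; not a corollary; Q11.4-sentence-2 already refuted in dim ≥ 3. [folklore] -/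
theorem trace_xi_sqrtNegFifteen_four [IsCyclotomicExtension {15} ℚ K] (hζ : IsPrimitiveRoot ζ 15) :
    Algebra.trace ℚ K ((ζ ^ 3 * (aeval ζ (derivative (cyclotomic 15 ℚ)))⁻¹) * ((1 + 2 * ζ ^ 5) * (1 + 2 * (ζ ^ 3 + ζ ^ 12))) * (ζ + ζ⁻¹) ^ 4) = 34 := by
  have h15 : ζ ^ 15 = 1 := hζ.pow_eq_one
  have hΦ := cyc_fifteen hζ
  rw [trace_of_key hζ (C (-9 : ℚ) + C (-22 : ℚ) * X + C (27 : ℚ) * X ^ 2 + C (-17 : ℚ) * X ^ 3 + C (7 : ℚ) * X ^ 4 +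
      C (22 : ℚ) * X ^ 5 + C (-25 : ℚ) * X ^ 6 + C (34 : ℚ) * X ^ 7) (by compute_degree) (by
    simp only [map_add, map_mul, map_pow, aeval_C, aeval_X, map_neg, eq_ratCast, Rat.cast_ofNat]
    linear_combination ((aeval ζ (derivative (cyclotomic 15 ℚ)))⁻¹ * (26 + 28 * ζ + 52 * ζ^2 + 27 * ζ^3 + 50 * ζ^4 + 30 * ζ^5 +
        10 * ζ^6)) * hΦ +
      ((aeval ζ (derivative (cyclotomic 15 ℚ)))⁻¹ * (26 + 2 * ζ + 24 * ζ^2 + 16 * ζ^4 + 4 * ζ^5 + 8 * ζ^6 +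
        16 * ζ^7 + 2 * ζ^8 + 24 * ζ^9 + 16 * ζ^11 + 4 * ζ^13)) * h15)]
  norm_num [coeff_X_pow, coeff_X, coeff_C]

/-- `Tr(ζ′sθ^5) = 18` for `ζ′ = ξ = ζ³/Φ₁₅′(ζ)`, `s = √−15 = (1 + 2ζ⁵)(1 + 2(ζ³ + ζ¹²))`, `θ = ζ + ζ⁻¹` (Euler evaluation). research route conditional on HC_CM; not a corollary; Q11.4-sentence-2 already refuted in dim ≥ 3. [folklore] -/
theorem trace_xi_sqrtNegFifteen_five [IsCyclotomicExtension {15} ℚ K] (hζ : IsPrimitiveRoot ζ 15) :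
    Algebra.trace ℚ K ((ζ ^ 3 * (aeval ζ (derivative (cyclotomic 15 ℚ)))⁻¹) * ((1 + 2 * ζ ^ 5) * (1 + 2 * (ζ ^ 3 + ζ ^ 12))) * (ζ + ζ⁻¹) ^ 5) = 18 := by
  have h15 : ζ ^ 15 = 1 := hζ.pow_eq_one
  have hΦ := cyc_fifteen hζ
  rw [trace_of_key hζ (C (-65 : ℚ) + C (52 : ℚ) * X + C (-30 : ℚ) * X ^ 2 + C (-9 : ℚ) * X ^ 3 + C (48 : ℚ) * X ^ 4 +
      C (-52 : ℚ) * X ^ 5 + C (47 : ℚ) * X ^ 6 + C (18 : ℚ) * X ^ 7) (by compute_degree) (by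
    simp only [map_add, map_mul, map_pow, aeval_C, aeval_X, map_neg, eq_ratCast, Rat.cast_ofNat]
    linear_combination ((aeval ζ (derivative (cyclotomic 15 ℚ)))⁻¹ * (46 + 58 * ζ + 108 * ζ^2 + 65 * ζ^3 + 93 * ζ^4 + 71 * ζ^5 +
        30 * ζ^6)) * hΦ +
      ((aeval ζ (derivative (cyclotomic 15 ℚ)))⁻¹ * (46 + 12 * ζ + 50 * ζ^2 + 2 * ζ^3 + 40 * ζ^4 + 4 * ζ^5 +
        24 * ζ^6 + 20 * ζ^7 + 10 * ζ^8 + 40 * ζ^9 + 2 * ζ^10 + 40 * ζ^11 + 20 * ζ^13 + 4 * ζ^15)) * h15)]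
  norm_num [coeff_X_pow, coeff_X, coeff_C]

/-- `Tr(ζ′sθ^6) = 130` for `ζ′ = ξ = ζ³/Φ₁₅′(ζ)`, `s = √−15 = (1 + 2ζ⁵)(1 + 2(ζ³ + ζ¹²))`, `θ = ζ + ζ⁻¹` (Euler evaluation). research route conditional on HC_CM; not a corollary; Q11.4-sentence-2 already refuted in dim ≥ 3. [folklore] -/
theorem trace_xi_sqrtNegFifteen_six [IsCyclotomicExtension {15} ℚ K] (hζ : IsPrimitiveRoot ζ 15) :
    Algebra.trace ℚ K ((ζ ^ 3 * (aeval ζ (derivative (cyclotomic 15 ℚ)))⁻¹) * ((1 + 2 * ζ ^ 5) * (1 + 2 * (ζ ^ 3 + ζ ^ 12))) * (ζ + ζ⁻¹) ^ 6) = 130 := by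
  have h15 : ζ ^ 15 = 1 := hζ.pow_eq_one
  have hΦ := cyc_fifteen hζ
  rw [trace_of_key hζ (C (-31 : ℚ) + C (-77 : ℚ) * X + C (108 : ℚ) * X ^ 2 + C (-65 : ℚ) * X ^ 3 + C (22 : ℚ) * X ^ 4 +
      C (77 : ℚ) * X ^ 5 + C (-99 : ℚ) * X ^ 6 + C (130 : ℚ) * X ^ 7) (by compute_degree) (by
    simp only [map_add, map_mul, map_pow, aeval_C, aeval_X, map_neg, eq_ratCast, Rat.cast_ofNat]
    linear_combination ((aeval ζ (derivative (cyclotomic 15 ℚ)))⁻¹ * (87 + 129 * ζ + 225 * ζ^2 + 153 * ζ^3 + 201 * ζ^4 +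
        30 * ζ^5 + 70 * ζ^6)) * hΦ +
      ((aeval ζ (derivative (cyclotomic 15 ℚ)))⁻¹ * (87 + 42 * ζ + 96 * ζ^2 + 14 * ζ^3 + 90 * ζ^4 + 6 * ζ^5 +
        64 * ζ^6 + 24 * ζ^7 + 34 * ζ^8 + 60 * ζ^9 + 12 * ζ^10 + 80 * ζ^11 + 2 * ζ^12 + 60 * ζ^13 + 24 * ζ^15 +
        4 * ζ^17)) * h15)]
  norm_num [coeff_X_pow, coeff_X, coeff_C]

/-- **The Gram datum `a` of `(E_ζ′, s)` in the real frame `θ^i` (`i < 4`)** for `ζ′ = ξ = ζ³/Φ₁₅′(ζ)` (principal type (1)),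
`s = √−15 = (1 + 2ζ⁵)(1 + 2(ζ³ + ζ¹²))`: the integer Hankel matrix `(−Tr(ζ′sθ^{i+j}))ᵢⱼ` (and `b = 0`, part 82 `hb_eq_zero`).
research route conditional on HC_CM; not a corollary; Q11.4-sentence-2 already refuted in dim ≥ 3. [cite: vanGeemen1994HodgeAV, Lemma 5.2 (2)–(3)] -/
theorem realPart_xi_sqrtNegFifteen [IsCyclotomicExtension {15} ℚ K] [IsCMField K] (hζ : IsPrimitiveRoot ζ 15)
    {x : Fin 4 → K} (hx : ∀ i, x i = (ζ + ζ⁻¹) ^ (i : ℕ)) {a : Matrix (Fin 4) (Fin 4) ℚ}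
    (ha : ∀ i j, a i j = Algebra.trace ℚ K ((ζ ^ 3 * (aeval ζ (derivative (cyclotomic 15 ℚ)))⁻¹) * x i * IsCMField.complexConj K (((1 + 2 * ζ ^ 5) * (1 + 2 * (ζ ^ 3 + ζ ^ 12))) * x j))) :
    a = !![-2, 0, -8, -4; 0, -8, -4, -34; -8, -4, -34, -18; -4, -34, -18, -130] := by
  rw [ha_eq (complexConj_sqrtNegFifteen hζ) (complexConj_thetaFrame hζ hx) ha]
  ext i j
  simp only [Matrix.of_apply, hx, ← pow_add]
  fin_cases i <;> fin_cases j <;> simp [trace_xi_sqrtNegFifteen_zero hζ, trace_xi_sqrtNegFifteen_one hζ, trace_xi_sqrtNegFifteen_two hζ, trace_xi_sqrtNegFifteen_three hζ, trace_xi_sqrtNegFifteen_four hζ, trace_xi_sqrtNegFifteen_five hζ, trace_xi_sqrtNegFifteen_six hζ]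

/-- **`det a = -3600`** for `ζ′ = ξ = ζ³/Φ₁₅′(ζ)`, `s = √−15 = (1 + 2ζ⁵)(1 + 2(ζ³ + ζ¹²))` (frame `θ^i`).
research route conditional on HC_CM; not a corollary; Q11.4-sentence-2 already refuted in dim ≥ 3. [cite: vanGeemen1994HodgeAV, Lemma 5.2 (3)] -/
theorem det_realPart_xi_sqrtNegFifteen [IsCyclotomicExtension {15} ℚ K] [IsCMField K] (hζ : IsPrimitiveRoot ζ 15)
    {x : Fin 4 → K} (hx : ∀ i, x i = (ζ + ζ⁻¹) ^ (i : ℕ)) {a : Matrix (Fin 4) (Fin 4) ℚ}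
    (ha : ∀ i j, a i j = Algebra.trace ℚ K ((ζ ^ 3 * (aeval ζ (derivative (cyclotomic 15 ℚ)))⁻¹) * x i * IsCMField.complexConj K (((1 + 2 * ζ ^ 5) * (1 + 2 * (ζ ^ 3 + ζ ^ 12))) * x j))) :
    a.det = -3600 := by
  rw [realPart_xi_sqrtNegFifteen hζ hx ha]
  simp [Matrix.det_succ_row_zero, Fin.sum_univ_succ, Fin.succAbove, Matrix.submatrix]
  norm_num

/-! ### §2 Invariance and class -/

/-- **For EVERY skew `ζ′` of PRINCIPAL type on `ℤ[ζ₁₅]` (`IsOfType 1 ζ′ ⊤`; `ζ′ = uξ`, `u` a real unit, `N(u) = 1`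
by THEOREM L (i) at `15`) the Gram determinant of `(E_ζ′, s₁₅)` in the frame `θ^i` is `-3600`** — in
particular for every `Φ` and every `Φ`-positive such `ζ′`; `(−1)² det a < 0`, the wrong sign for Weil signature `(2,2)`
[vG94 Lemma 5.2 (4)] — cf. the census NO row (part 75 `not_exists_principal_fifteen_…`).
research route conditional on HC_CM; not a corollary; Q11.4-sentence-2 already refuted in dim ≥ 3. [cite: vanGeemen1994HodgeAV, Lemma 5.2 (3)–(4)] [cite: Shimura1998, §14.3 Prop. 5, p. 104] -/
theorem det_realPart_principal_sqrtNegFifteen [IsCyclotomicExtension {15} ℚ K] [IsCMField K]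
    (hζ : IsPrimitiveRoot ζ 15) {ζ' : K} (hζ' : IsCMField.complexConj K ζ' = -ζ')
    (hT : CMTypeLattice.IsOfType (1 : (FractionalIdeal (𝓞 K)⁰ K)ˣ) ζ' ⊤)
    {x : Fin 4 → K} (hx : ∀ i, x i = (ζ + ζ⁻¹) ^ (i : ℕ)) {a : Matrix (Fin 4) (Fin 4) ℚ}
    (ha : ∀ i j, a i j = Algebra.trace ℚ K (ζ' * x i * IsCMField.complexConj K (((1 + 2 * ζ ^ 5) * (1 + 2 * (ζ ^ 3 + ζ ^ 12))) * x j))) :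
    a.det = -3600 := by
  obtain ⟨ωb, hωb⟩ := exists_basis_thetaPow hζ
  have hx' : ∀ i, x i = (ωb i : K) := fun i => (hx i).trans (hωb i).symm
  rw [det_realPart_eq_of_isOfType ωb (complexConj_sqrtNegFifteen hζ) hx' (norm_realUnits_pos_fifteen hζ)
    (complexConj_xi_fifteen hζ) (xi_ne_zero hζ 3) hζ' (isOfType_one_xi_top hζ 3) hT (fun i j => rfl) ha]
  exact det_realPart_xi_sqrtNegFifteen hζ hx (fun i j => rfl)

/-- **The class of `-3600 = −60²` in `ℚˣ/Nm(ℚ(s√−15)ˣ)` is `[−1]`, NOT the split class `[1]`** (`−1 < 0` is not a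
norm from an imaginary quadratic field): were `E_ζ′` a polarisation of a Weil-type CM fourfold this would be its
component — it is not, by the sign (docstring above).
research route conditional on HC_CM; not a corollary; Q11.4-sentence-2 already refuted in dim ≥ 3. [cite: vanGeemen1994HodgeAV, Lemma 5.2 (3)–(4) and (5.4.1)] -/
theorem mk0_det_principal_sqrtNegFifteen :
    (QuotientGroup.mk (Units.mk0 (-3600 : ℚ) (by norm_num)) : weilNormResidueGroup 15) =
        QuotientGroup.mk (Units.mk0 (-1 : ℚ) (by norm_num)) ∧
      (QuotientGroup.mk (Units.mk0 (-1 : ℚ) (by norm_num)) : weilNormResidueGroup 15) ≠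
        splitDiscriminantClass 2 15 := by
  constructor
  · rw [QuotientGroup.eq]
    have e : (Units.mk0 (-3600 : ℚ) (by norm_num))⁻¹ * Units.mk0 (-1 : ℚ) (by norm_num) =
        Units.mk0 ((1 / 3600) : ℚ) (by norm_num) := Units.ext (by norm_num)
    rw [e]
    exact mem_normUnitsSubgroup_of_sq_add_mul_sq _ ((1 / 60) : ℚ) 0 (by norm_num)
  · refine mk_ne_split_of_even (by decide) _ (not_mem_normUnitsSubgroup_of_not_exists _ ?_)
    rintro ⟨x, y, h⟩
    nlinarith [sq_nonneg x, sq_nonneg y]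

end Summit.HodgeConjecture.Ring2WeilCoverage.WeilGramLevel15SqrtNegFifteen

end
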